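import Summits.FinalStateConjecture.FinalStateConjecture.Theorems.PhotonSphereChannelsTameCensorshipLensCausality
import Literature.Geometry.Lorentzian.DataHypersurfaceLocalAcausal
import Literature.Geometry.Lorentzian.LocalCauchyLens
import HarnessLib

/-!
# Crux `TameCensorship` (stmt-FinalStateConjecture-10047), line `crush-the-swallowed-interior`,
# fact-stub F1 `stub_factFutureCauchyCrushBound` — IV: local Cauchy lenses about the points of an
# achronal immersed spacelike hypersurface

Let `𝓢` be a (four-dimensional) spacetime, `f : N → 𝓢` a smooth spacelike immersion of a
`3`-manifold with a smooth timelike unit normal field `ν` which is future directed, and suppose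
the image `S = f(N)` is achronal. **Then every point `f y` has an open neighbourhood `V` such that
`S ∩ V` is a Cauchy hypersurface of the open sub-spacetime `(V, g|_V, τ|_V)`**
(`exists_lens_of_isSpacelikeImmersion`) — the hypothesis `hL` of
`…TameCensorshipFutureCauchyDomain` / `…TameCensorshipLensDomain`.

Proof. In Gaussian normal coordinates `E(x, t) = exp_{f x}(t ν x)` about `f y` — a local
diffeomorphism `Φ` at `(y, 0)` (`isLocalDiffeomorphAt_normalExp_zero`,
`Literature/Geometry/Riemannian/NormalExponentialMap.lean`; it only needs `df_y` injective and
`ν y ∉ range df_y`, so immersions are allowed) — the normal coordinate `h = t ∘ Φ⁻¹` is smooth near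
`f y`, vanishes exactly on the local sheet `S₀ = {q ∈ Φ.target | h q = 0} ⊆ S` and has
`dh(u) = -g(ν y, u) > 0` for future-directed causal `u` (the computation of
`DataEmbedding.exists_expMap_pastCausal_not_mem_range`, `DataHypersurfaceLocalAcausal.lean`, for an
immersion). The lens lemma `LorentzianMetric.exists_isCauchyHypersurface_restrict_of_timeFunction`
(`LocalCauchyLens.lean`) gives an open `V ∋ f y` in which `S₀ ∩ V` is a Cauchy hypersurface; and
`S ∩ V = S₀ ∩ V`, because a point of `S ∩ V` off `S₀` would be in `I⁺(S₀) ∪ I⁻(S₀) ⊆ I⁺(S) ∪ I⁻(S)`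
(trichotomy in the lens, `mem_union_of_lens`), against the achronality of `S`.

Everything is proved; no definitions, no named facts.

## References

* B. O'Neill, *Semi-Riemannian geometry with applications to relativity*, Academic Press 1983,
  Ch. 14, Lemma 14.42 ff. (Gaussian normal coordinates), Thm. 14.38; Ch. 5, Prop. 5.34.
  [ONeillSemiRiemannian1983]
* S. W. Hawking, G. F. R. Ellis, *The large scale structure of space-time*, CUP 1973, §7.4,
  p. 234, Lemma 7.4.4 (1) (the lens regions `𝒰`); §6.5. [HawkingEllis1973CUP]
* J. M. Lee, *Introduction to Riemannian Manifolds*, 2nd ed. (2018), Thm. 5.25.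
  [LeeRiemannianManifolds2018]
-/

noncomputable section

-- The tree namespace `Summit.FinalStateConjecture.FinalStateConjecture.…` (summit = sub-problem)
-- repeats a component by design (D-0022), which the `dupNamespace` linter would flag on every decl.
set_option linter.dupNamespace false

open Bundle Set Filter Function Topology TopologicalSpace
open scoped Manifold ContDiff Topology

open Literature.Geometry.Lorentzian Literature.Geometry.Riemannian

namespace Summit.FinalStateConjecture.FinalStateConjecture.Theorems.PhotonSphereChannels.TameCensorshipCrush

universe u

/-- **A local time function at a point of an immersed spacelike hypersurface.** For a spacetime
`𝓢`, a smooth spacelike immersion `f : N → 𝓢` of a `3`-manifold with smooth future unit normal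
field `ν`, and `y ∈ N`, there is a function `h : 𝓢 → ℝ`, smooth at `f y`, with `h (f y) = 0`,
`dh(u) > 0` for every future-directed `u ∈ T_{f y}𝓢`, and an open `U ∋ f y` on which
`{h = 0} ⊆ f(N)` — the normal coordinate of the Gaussian normal chart `(x, t) ↦ exp_{f x}(t ν x)`
about `f y` (`isLocalDiffeomorphAt_normalExp_zero`), with `dh = -g(ν y, ·)` at `f y`.
[cite: ONeillSemiRiemannian1983, Ch. 14, Lemma 14.42 ff.; Ch. 5, Prop. 5.34]
[cite: LeeRiemannianManifolds2018, Thm. 5.25] -/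
theorem exists_timeFunction_of_isSpacelikeImmersion (𝓢 : Spacetime.{u} 4)
    [𝓢.metric.HasLeviCivita] {N : Type u} [TopologicalSpace N] [ChartedSpace E3 N]
    [IsManifold (𝓡 3) ∞ N] {f : N → 𝓢.carrier} (hf : 𝓢.metric.IsSpacelikeImmersion (𝓡 3) f)
    {ν : NormalField (𝓡 4) f}
    (hν : ContMDiff (𝓡 3) (𝓡 4).tangent ∞
      (fun y ↦ (TotalSpace.mk' E4 (f y) (ν y) : TangentBundle (𝓡 4) 𝓢.carrier)))
    (hfun : 𝓢.metric.IsFutureUnitNormal (𝓡 3) 𝓢.timeOrientation f ν) (y : N) :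
    ∃ (h : 𝓢.carrier → ℝ) (U : Set 𝓢.carrier), IsOpen U ∧ f y ∈ U ∧
      ContMDiffAt (𝓡 4) 𝓘(ℝ, ℝ) ∞ h (f y) ∧ h (f y) = 0 ∧
      (∀ u : TangentSpace (𝓡 4) (f y), 𝓢.timeOrientation.IsFutureDirected u →
        (0 : ℝ) < mfderiv (𝓡 4) 𝓘(ℝ, ℝ) h (f y) u) ∧
      ∀ q ∈ U, h q = 0 → q ∈ range f := by
  -- regularity instances of the smooth spacetime metric
  haveI h1 : CovariantDerivative.ContMDiffCovariantDerivative 𝓢.metric.leviCivita 1 :=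
    ⟨𝓢.metric.isLocallyContMDiff_leviCivita_holds 1 (by exact_mod_cast le_top) univ isOpen_univ⟩
  haveI hinf : CovariantDerivative.ContMDiffCovariantDerivative 𝓢.metric.leviCivita ∞ :=
    contMDiffCovariantDerivative_leviCivita_infty 𝓢.metric.toPseudoRiemannianMetric le_rfl
  set cov := 𝓢.metric.leviCivita with hcov
  letI : NormedAddCommGroup (TangentSpace (𝓡 4) (f y)) := inferInstanceAs (NormedAddCommGroup E4)
  letI : NormedSpace ℝ (TangentSpace (𝓡 4) (f y)) := inferInstanceAs (NormedSpace ℝ E4)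
  /- (1) Gaussian normal coordinates: the normal exponential map is a local diffeomorphism at
    `(y, 0)` -/
  have hιinj : Injective (mfderiv (𝓡 3) (𝓡 4) f y) := hf.injective_mfderiv y
  have hνz : ν y ∉ range (mfderiv (𝓡 3) (𝓡 4) f y) :=
    not_mem_range_of_normal (F := E4) (F' := E3) (A := mfderiv (𝓡 3) (𝓡 4) f y)
      (𝓢.metric.val (f y)) (ne_of_eq_of_ne (hfun.1.2 y) (by norm_num)) (fun w ↦ hfun.1.1 y w)
  have hdim : Module.finrank ℝ E3 + 1 = Module.finrank ℝ E4 := by simp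
  obtain ⟨Φ, hΦ0, hΦeq⟩ := isLocalDiffeomorphAt_normalExp_zero (cov := cov) (k := (⊤ : ℕ∞))
    (I := 𝓡 4) (I' := 𝓡 3) le_top hν hιinj hνz hdim
  set nE : N × ℝ → 𝓢.carrier := fun q ↦ expMap cov (f q.1) (q.2 • ν q.1) with hnE
  have hnE0 : ∀ x, nE (x, 0) = f x := fun x ↦ normalExp_zero (cov := cov) x
  have hΦs : Φ (y, 0) = f y := by rw [← hΦeq hΦ0]; exact hnE0 y
  have hst : f y ∈ Φ.target := by rw [← hΦs]; exact Φ.map_source hΦ0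
  /- (2) the normal coordinate `h = t ∘ Φ⁻¹` -/
  set h : 𝓢.carrier → ℝ := fun q ↦ (Φ.toPartialEquiv.symm q).2 with hh
  have hhs : ContMDiffOn (𝓡 4) 𝓘(ℝ, ℝ) ∞ h Φ.target :=
    contMDiff_snd.comp_contMDiffOn Φ.contMDiffOn_invFun
  have hhat : ContMDiffAt (𝓡 4) 𝓘(ℝ, ℝ) ∞ h (f y) := hhs.contMDiffAt (Φ.open_target.mem_nhds hst)
  have hhd : MDifferentiableAt (𝓡 4) 𝓘(ℝ, ℝ) h (f y) := hhat.mdifferentiableAt (by simp)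
  have hh0 : h (f y) = 0 := by
    show (Φ.toPartialEquiv.symm (f y)).2 = 0
    rw [← hΦs, Φ.toPartialEquiv.left_inv hΦ0]
  /- (3) the differential of `h` at `f y`: `dh(u) = -g(ν y, u)` -/
  have hkey : ∀ u : TangentSpace (𝓡 4) (f y),
      mfderiv (𝓡 4) 𝓘(ℝ, ℝ) h (f y) u = -(𝓢.metric.val (f y) (ν y) u) := by
    have hΦd : MDifferentiableAt ((𝓡 3).prod 𝓘(ℝ, ℝ)) (𝓡 4) Φ (y, 0) :=
      (Φ.contMDiffOn_toFun.contMDiffAt (Φ.open_source.mem_nhds hΦ0)).mdifferentiableAt (by simp)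
    have hcomp : mfderiv ((𝓡 3).prod 𝓘(ℝ, ℝ)) 𝓘(ℝ, ℝ) (h ∘ Φ) (y, 0) =
        (mfderiv (𝓡 4) 𝓘(ℝ, ℝ) h (f y)).comp (mfderiv ((𝓡 3).prod 𝓘(ℝ, ℝ)) (𝓡 4) Φ (y, 0)) := by
      rw [← hΦs] at hhd
      rw [mfderiv_comp (y, 0) hhd hΦd, hΦs]
    have hsnd : mfderiv ((𝓡 3).prod 𝓘(ℝ, ℝ)) 𝓘(ℝ, ℝ) (h ∘ Φ) (y, 0) =
        mfderiv ((𝓡 3).prod 𝓘(ℝ, ℝ)) 𝓘(ℝ, ℝ) (Prod.snd : N × ℝ → ℝ) (y, 0) := by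
      refine Filter.EventuallyEq.mfderiv_eq ?_
      filter_upwards [Φ.open_source.mem_nhds hΦ0] with q hq
      show (Φ.toPartialEquiv.symm (Φ q)).2 = q.2
      rw [Φ.toPartialEquiv.left_inv hq]
    have hdΦ : ∀ q : TangentSpace ((𝓡 3).prod 𝓘(ℝ, ℝ)) (y, (0 : ℝ)),
        mfderiv ((𝓡 3).prod 𝓘(ℝ, ℝ)) (𝓡 4) Φ (y, 0) q =
          mfderiv (𝓡 3) (𝓡 4) f y q.1 + q.2 • ν y := by
      intro q
      have heq : mfderiv ((𝓡 3).prod 𝓘(ℝ, ℝ)) (𝓡 4) Φ (y, 0) =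
          mfderiv ((𝓡 3).prod 𝓘(ℝ, ℝ)) (𝓡 4) nE (y, 0) := by
        refine Filter.EventuallyEq.mfderiv_eq ?_
        filter_upwards [Φ.open_source.mem_nhds hΦ0] with q hq
        exact (hΦeq hq).symm
      rw [heq]
      exact mfderiv_normalExp_zero_apply (cov := cov) (k := (⊤ : ℕ∞)) le_top hν y q
    have hval : ∀ q : TangentSpace ((𝓡 3).prod 𝓘(ℝ, ℝ)) (y, (0 : ℝ)),
        mfderiv (𝓡 4) 𝓘(ℝ, ℝ) h (f y) (mfderiv (𝓡 3) (𝓡 4) f y q.1 + q.2 • ν y) = q.2 := by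
      intro q
      have e1 : mfderiv ((𝓡 3).prod 𝓘(ℝ, ℝ)) 𝓘(ℝ, ℝ) (h ∘ Φ) (y, 0) q =
          mfderiv (𝓡 4) 𝓘(ℝ, ℝ) h (f y) (mfderiv ((𝓡 3).prod 𝓘(ℝ, ℝ)) (𝓡 4) Φ (y, 0) q) := by
        rw [hcomp]; rfl
      rw [hdΦ q, hsnd, mfderiv_snd] at e1
      exact e1.symm
    obtain ⟨L, hL⟩ := exists_continuousLinearEquiv_coprod_toSpanSingleton (F := E4) (F' := E3)
      (A := mfderiv (𝓡 3) (𝓡 4) f y) (v := ν y) hιinj hνz hdim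
    intro u
    set q : E3 × ℝ := L.symm u with hq
    have hu : u = mfderiv (𝓡 3) (𝓡 4) f y q.1 + q.2 • ν y := by
      have e1 : (L : E3 × ℝ →L[ℝ] E4) q = u := L.apply_symm_apply u
      rw [hL] at e1
      rw [← e1]
      rfl
    rw [hu, hval q, map_add, map_smul, hfun.1.1 y q.1, hfun.1.2 y]
    simp
  /- (4) conclusion -/
  refine ⟨h, Φ.target, Φ.open_target, hst, hhat, hh0, fun u hu ↦ ?_, fun q hq hq0 ↦ ?_⟩
  · rw [hkey u]
    have hνt : 𝓢.metric.IsTimelike (ν y) := by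
      show 𝓢.metric.val _ (ν y) (ν y) < 0
      rw [hfun.1.2 y]
      norm_num
    have := (hfun.2 y).val_lt_zero 𝓢.timeOrientation hνt hu
    linarith
  · -- a point of `Φ.target` with normal coordinate `0` is on the local sheet `f(N)`
    set p := Φ.toPartialEquiv.symm q with hp
    have hps : p ∈ Φ.source := Φ.map_target hq
    have hp2 : p = (p.1, 0) := Prod.ext rfl hq0
    have hqp : q = Φ p := (Φ.toPartialEquiv.right_inv hq).symm
    refine ⟨p.1, ?_⟩
    rw [hqp, ← hΦeq hps, hp2]
    exact (hnE0 p.1).symm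

/-- **Local Cauchy lenses about the points of an achronal immersed spacelike hypersurface.** Let
`𝓢` be a spacetime, `f : N → 𝓢` a smooth spacelike immersion of a `3`-manifold with smooth future
unit normal field, and suppose `S = f(N)` is achronal. Then every `f y` lies in an open `V` such
that `S ∩ V` is a Cauchy hypersurface of the open sub-spacetime `(V, g|_V, τ|_V)`: the lens of the
normal-coordinate time function `h` at `f y`
(`LorentzianMetric.exists_isCauchyHypersurface_restrict_of_timeFunction`) for the local sheet
`S₀ = {h = 0} ⊆ S`, in which `S ∩ V = S₀ ∩ V` by achronality and the trichotomy
`V ⊆ S₀ ∪ I⁺(S₀) ∪ I⁻(S₀)` (`mem_union_of_lens`). Hawking–Ellis 1973, §7.4, Lemma 7.4.4 (1);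
O'Neill 1983, Ch. 14, Thm. 14.38 (local form).
[cite: HawkingEllis1973CUP, §7.4, p. 234, Lemma 7.4.4 (1)]
[cite: ONeillSemiRiemannian1983, Ch. 14, Lemma 14.42 and Thm. 14.38 (pp. 421–425)] -/
theorem exists_lens_of_isSpacelikeImmersion (𝓢 : Spacetime.{u} 4) [𝓢.metric.HasLeviCivita]
    {N : Type u} [TopologicalSpace N] [ChartedSpace E3 N] [IsManifold (𝓡 3) ∞ N]
    {f : N → 𝓢.carrier} (hf : 𝓢.metric.IsSpacelikeImmersion (𝓡 3) f) {ν : NormalField (𝓡 4) f}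
    (hν : ContMDiff (𝓡 3) (𝓡 4).tangent ∞
      (fun y ↦ (TotalSpace.mk' E4 (f y) (ν y) : TangentBundle (𝓡 4) 𝓢.carrier)))
    (hfun : 𝓢.metric.IsFutureUnitNormal (𝓡 3) 𝓢.timeOrientation f ν)
    (hA : 𝓢.metric.IsAchronal 𝓢.timeOrientation (range f)) (y : N) :
    ∃ V : Opens 𝓢.carrier, f y ∈ V ∧
      (𝓢.metric.restrict PseudoRiemannianMetric.contMDiff_restrict_holds V).IsCauchyHypersurface
        (𝓢.timeOrientation.restrict PseudoRiemannianMetric.contMDiff_restrict_holds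
          𝓢.timeOrientation.contMDiff_restrict_holds V)
        (Subtype.val ⁻¹' range f) := by
  obtain ⟨h, U, hUo, hyU, hhat, hh0, hdh, hsheet⟩ :=
    exists_timeFunction_of_isSpacelikeImmersion 𝓢 hf hν hfun y
  -- the local sheet
  set S₀ : Set 𝓢.carrier := U ∩ {q | h q = 0} with hS₀
  have hS₀S : S₀ ⊆ range f := fun q hq ↦ hsheet q hq.1 hq.2
  have hS₀ev : ∀ᶠ q in 𝓝 (f y), q ∈ S₀ ↔ h q = 0 := by
    filter_upwards [hUo.mem_nhds hyU] with q hq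
    exact ⟨fun hq' ↦ hq'.2, fun hq' ↦ ⟨hq, hq'⟩⟩
  obtain ⟨V, hyV, -, hV⟩ :=
    LorentzianMetric.exists_isCauchyHypersurface_restrict_of_timeFunction
      (g := 𝓢.metric) (τ := 𝓢.timeOrientation) (by exact_mod_cast le_top)
      PseudoRiemannianMetric.contMDiff_restrict_holds 𝓢.timeOrientation.contMDiff_restrict_holds
      (hhat.of_le (by exact_mod_cast le_top)) hh0 hdh hS₀ev univ_mem
  refine ⟨V, hyV, ?_⟩
  -- `S ∩ V = S₀ ∩ V`
  have hset : (Subtype.val ⁻¹' range f : Set V) = Subtype.val ⁻¹' S₀ := by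
    ext q
    refine ⟨fun hq ↦ ?_, fun hq ↦ hS₀S hq⟩
    rcases mem_union_of_lens PseudoRiemannianMetric.contMDiff_restrict_holds
      𝓢.timeOrientation.contMDiff_restrict_holds (WithTop.coe_le_coe.mpr le_top : (2 : ℕ∞ω) ≤ ∞)
      hV q.2 with h' | h' | h'
    · exact h'
    · -- `q ∈ I⁺(S₀) ⊆ I⁺(S)`, with `q ∈ S`: against achronality
      exfalso
      obtain ⟨s₀, hs₀, hqs₀⟩ : ∃ s₀ ∈ S₀, (q : 𝓢.carrier) ∈
          𝓢.metric.chronologicalFuture 𝓢.timeOrientation {s₀} := by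
        rw [LorentzianMetric.chronologicalFuture_eq_biUnion] at h'
        simpa only [mem_iUnion, exists_prop] using h'
      exact hA s₀ (hS₀S hs₀) q hq hqs₀
    · exfalso
      obtain ⟨s₀, hs₀, hqs₀⟩ : ∃ s₀ ∈ S₀, (q : 𝓢.carrier) ∈
          𝓢.metric.chronologicalFuture 𝓢.timeOrientation.reverse {s₀} := by
        have h'' : (q : 𝓢.carrier) ∈ 𝓢.metric.chronologicalFuture 𝓢.timeOrientation.reverse S₀ := h'
        rw [LorentzianMetric.chronologicalFuture_eq_biUnion] at h''
        simpa only [mem_iUnion, exists_prop] using h''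
      have hqs₀' : (q : 𝓢.carrier) ∈ 𝓢.metric.chronologicalPast 𝓢.timeOrientation {s₀} := hqs₀
      exact hA q hq s₀ (hS₀S hs₀)
        (LorentzianMetric.mem_chronologicalFuture_of_mem_chronologicalPast hqs₀')
  rw [hset]
  exact hV

end Summit.FinalStateConjecture.FinalStateConjecture.Theorems.PhotonSphereChannels.TameCensorshipCrush

end
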